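import Mathlib
import Summits.AnomalousDissipation.AnomalousDissipation.Theorems.PointFluxCone.Negative.ClassicalFluxRigidityRadialTests
import Summits.AnomalousDissipation.AnomalousDissipation.Theorems.PointFluxCone.Negative.ClassicalFluxRigidityTransport

/-!
# Classical DSS flux rigidity, part 3/4: the level functionals — transport invariance, DSS level
shift, and the limits `c → 0`, `c → ∞`

Support file (cdisprove seat, crux `PointSink.PointFluxCone`, stmt-AnomalousDissipation-19033) for
`Theorems/PointFluxCone/Negative/ClassicalFluxRigidity.lean`.

Write `B = ½|V|² + P` for the Bernoulli head and `r = ⟪V, x⟫/|x|²` for the radial factor. For a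
`C¹` steady Euler pair `(V, P)` off the origin: (a) TRANSPORT INVARIANCE — for every `C¹` profile
`h`, `∫ h(B) r ζ(|x|²) = ∫ h(B) r ζ(|x|²/L)` (`L ≥ 1`, `ζ` continuous supported in
`[a, b] ⊂ (0, ∞)`): test `div (h(B) V) = 0` against the radial test of part 1; (b) LEVEL SHIFT —
for a DSS pair of degrees `(−2/3, −4/3)` with ratio `λ`, the change of variables `x = λy` gives
`∫ c·arctan(B/c) r ζ(|x|²/λ²) = ∫ c'·arctan(B/c') r ζ(|x|²)` with `c' = λ^{4/3} c` (all powers of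
`λ` cancel exactly at degree `−2/3`); hence the level functional
`N_c(ζ) = ∫ c·arctan(B/c) r ζ(|x|²)` satisfies `N_c = N_{λ^{4/3} c}`; (c) LIMITS — `N_{c_k} → ∫ B r ζ`
along `c_k → ∞` and `N_{c_k} → 0` along `c_k → 0⁺` (dominated convergence,
`|c·arctan(s/c)| ≤ |s|`). Consequently `∫ B r ζ(|x|²) = 0` for every admissible profile
(`integral_flux_weight_eq_zero`). No definitions are introduced (integrals are written out).
[folklore]
-/

set_option linter.dupNamespace false  -- `Summit.AnomalousDissipation.AnomalousDissipation` is the mandated summit/problem namespace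

noncomputable section

open MeasureTheory Metric Filter Topology Set Function
open scoped InnerProductSpace RealInnerProductSpace
open Literature.Analysis.FluidPDE

namespace Summit.AnomalousDissipation.AnomalousDissipation.Theorems.PointFluxCone.Negative

section Vanish

/-- The dilated profile `ζ (·/L)` vanishes on `(-∞, a]` and `[L b, ∞)`. [folklore] -/
theorem comp_div_vanish {ζ : ℝ → ℝ} {a b L : ℝ} (hL : 1 ≤ L) (ha : 0 < a)
    (hζa : ∀ u, u ≤ a → ζ u = 0) (hζb : ∀ u, b ≤ u → ζ u = 0) :
    (∀ u, u ≤ a → ζ (u / L) = 0) ∧ ∀ u, L * b ≤ u → ζ (u / L) = 0 := by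
  have hL0 : 0 < L := lt_of_lt_of_le one_pos hL
  refine ⟨fun u hu => ?_, fun u hu => hζb _ ?_⟩
  · have := sub_eq_zero_of_le hL ha hζa hu
    rw [hζa u hu, zero_sub, neg_eq_zero] at this
    exact this
  · rw [le_div_iff₀ hL0]; linarith

end Vanish

section Functionals

variable {lam : ℝ} {V : EuclideanSpace ℝ (Fin 3) → EuclideanSpace ℝ (Fin 3)}
  {P : EuclideanSpace ℝ (Fin 3) → ℝ}

/-- The radial factor `⟪V x, x⟫/|x|²` is continuous off the origin. [folklore] -/
theorem continuousOn_radial (hV : ContDiffOn ℝ 1 V {x | x ≠ 0}) :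
    ContinuousOn (fun x : EuclideanSpace ℝ (Fin 3) => ⟪V x, x⟫ / ‖x‖ ^ 2) {x | x ≠ 0} :=
  fun x hx => ((hV.continuousOn x hx).inner continuousWithinAt_id).div
    ((continuous_norm.pow 2).continuousWithinAt) (by simpa using hx)

/-- For a continuous profile `h`, the integrand `h(B) · (⟪V,x⟫/|x|²)` is continuous off the
origin. [folklore] -/
theorem continuousOn_profileIntegrand (hV : ContDiffOn ℝ 1 V {x | x ≠ 0})
    (hP : ContDiffOn ℝ 1 P {x | x ≠ 0}) {h : ℝ → ℝ} (hh : Continuous h) :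
    ContinuousOn (fun x : EuclideanSpace ℝ (Fin 3) =>
      h (‖V x‖ ^ 2 / 2 + P x) * (⟪V x, x⟫ / ‖x‖ ^ 2)) {x | x ≠ 0} :=
  (hh.comp_continuousOn (continuousOn_head hV hP)).mul (continuousOn_radial hV)

/-- The flux integrand `B · (⟪V,x⟫/|x|²)` is continuous off the origin. [folklore] -/
theorem continuousOn_fluxIntegrand (hV : ContDiffOn ℝ 1 V {x | x ≠ 0})
    (hP : ContDiffOn ℝ 1 P {x | x ≠ 0}) :
    ContinuousOn (fun x : EuclideanSpace ℝ (Fin 3) =>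
      (‖V x‖ ^ 2 / 2 + P x) * (⟪V x, x⟫ / ‖x‖ ^ 2)) {x | x ≠ 0} :=
  (continuousOn_head hV hP).mul (continuousOn_radial hV)

/-- **Step 1 (transport invariance).** For a `C¹` steady Euler pair off the origin and a `C¹`
profile `h`, the functional `ζ ↦ ∫ h(B) ⟪V,x⟫|x|⁻² ζ(|x|²)` is invariant under `ζ ↦ ζ(·/L)`,
`L ≥ 1`: the two differ by `½ ∫ ⟪h(B)V, ∇θ⟫ = 0` for the radial test `θ` of part 1. [folklore] -/
theorem integral_transport_invariant (hV : ContDiffOn ℝ 1 V {x | x ≠ 0})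
    (hP : ContDiffOn ℝ 1 P {x | x ≠ 0})
    (hdiv : ∀ x : EuclideanSpace ℝ (Fin 3), x ≠ 0 → VectorCalculus.divergence V x = 0)
    (hmom : ∀ x : EuclideanSpace ℝ (Fin 3), x ≠ 0 → convect V V x + gradient P x = 0)
    {h w : ℝ → ℝ} (hh : ∀ s, HasDerivAt h (w s) s) (hw : Continuous w)
    {ζ : ℝ → ℝ} (hζ : Continuous ζ) {a b L : ℝ} (ha : 0 < a) (hab : a ≤ b) (hL : 1 ≤ L)
    (hζa : ∀ u, u ≤ a → ζ u = 0) (hζb : ∀ u, b ≤ u → ζ u = 0) :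
    ∫ x, h (‖V x‖ ^ 2 / 2 + P x) * (⟪V x, x⟫ / ‖x‖ ^ 2) * ζ (‖x‖ ^ 2) =
      ∫ x, h (‖V x‖ ^ 2 / 2 + P x) * (⟪V x, x⟫ / ‖x‖ ^ 2) * ζ (‖x‖ ^ 2 / L) := by
  have hh1 : ContDiff ℝ 1 h := by
    rw [contDiff_one_iff_deriv]
    refine ⟨fun s => (hh s).differentiableAt, ?_⟩
    have : deriv h = w := funext fun s => (hh s).deriv
    rwa [this]
  -- the renormalised field
  set W : EuclideanSpace ℝ (Fin 3) → EuclideanSpace ℝ (Fin 3) :=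
    fun y => h (‖V y‖ ^ 2 / 2 + P y) • V y with hW_def
  have hW : ContDiffOn ℝ 1 W {x | x ≠ 0} := contDiffOn_head_smul hh1 hV hP
  have hdivW : ∀ x : EuclideanSpace ℝ (Fin 3), x ≠ 0 → VectorCalculus.divergence W x = 0 :=
    fun x hx => divergence_head_smul_eq_zero hh
      ((hV.differentiableOn one_ne_zero).differentiableAt (isOpen_ne.mem_nhds hx))
      ((hP.differentiableOn one_ne_zero).differentiableAt (isOpen_ne.mem_nhds hx))
      (hdiv x hx) (hmom x hx)
  -- integration by parts against the radial test
  obtain ⟨θ, hθC, hθc, hθ0, hθg⟩ := exists_radialTest hζ hL ha hab hζa hζb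
  have hibp := integral_inner_gradient_eq_zero_off_zero hW hdivW hθC hθc hθ0
  have hpt : ∀ x : EuclideanSpace ℝ (Fin 3), ⟪W x, gradient θ x⟫ =
      2 * (h (‖V x‖ ^ 2 / 2 + P x) * (⟪V x, x⟫ / ‖x‖ ^ 2) * ζ (‖x‖ ^ 2) -
        h (‖V x‖ ^ 2 / 2 + P x) * (⟪V x, x⟫ / ‖x‖ ^ 2) * ζ (‖x‖ ^ 2 / L)) := by
    intro x
    rw [hθg W x, hW_def]
    simp only [real_inner_smul_left]
    ring
  have hζ' : Continuous fun u => ζ (u / L) := hζ.comp (continuous_id.div_const L)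
  obtain ⟨hζa', hζb'⟩ := comp_div_vanish hL ha hζa hζb
  have hhc : Continuous h := continuous_iff_continuousAt.2 fun s => (hh s).continuousAt
  have hi1 : Integrable fun x : EuclideanSpace ℝ (Fin 3) =>
      h (‖V x‖ ^ 2 / 2 + P x) * (⟪V x, x⟫ / ‖x‖ ^ 2) * ζ (‖x‖ ^ 2) :=
    integrable_mul_radial (continuousOn_profileIntegrand hV hP hhc) hζ ha hab hζa hζb
  have hi2 : Integrable fun x : EuclideanSpace ℝ (Fin 3) =>
      h (‖V x‖ ^ 2 / 2 + P x) * (⟪V x, x⟫ / ‖x‖ ^ 2) * ζ (‖x‖ ^ 2 / L) :=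
    integrable_mul_radial (continuousOn_profileIntegrand hV hP hhc) hζ' ha
      (hab.trans (by nlinarith [lt_of_lt_of_le ha hab])) hζa' hζb'
  rw [integral_congr_ae (Eventually.of_forall hpt), integral_const_mul, integral_sub hi1 hi2]
    at hibp
  linarith

/-- **Step 2 (DSS level shift).** For a DSS pair of degrees `(−2/3, −4/3)`, dilating the profile
shifts the level of the arctan family: `N_c(ζ(·/λ²)) = N_{c'}(ζ)` with `c' = c / λ^{−4/3}`
(the total power of `λ` is `3 − 4/3 − 2/3 − 1 = 0`). [folklore] -/
theorem integral_level_comp_div_eq (hlam : 1 < lam)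
    (hVs : ∀ x : EuclideanSpace ℝ (Fin 3), x ≠ 0 → V (lam • x) = lam ^ (-(2 / 3 : ℝ)) • V x)
    (hPs : ∀ x : EuclideanSpace ℝ (Fin 3), x ≠ 0 → P (lam • x) = lam ^ (-(4 / 3 : ℝ)) * P x)
    (c : ℝ) (ζ : ℝ → ℝ) :
    ∫ x, c * Real.arctan ((‖V x‖ ^ 2 / 2 + P x) / c) * (⟪V x, x⟫ / ‖x‖ ^ 2) *
        ζ (‖x‖ ^ 2 / lam ^ 2) =
      ∫ x, c / lam ^ (-(4 / 3 : ℝ)) *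
        Real.arctan ((‖V x‖ ^ 2 / 2 + P x) / (c / lam ^ (-(4 / 3 : ℝ)))) *
          (⟪V x, x⟫ / ‖x‖ ^ 2) * ζ (‖x‖ ^ 2) := by
  have hlam0 : 0 < lam := zero_lt_one.trans hlam
  set μ : ℝ := lam ^ (-(2 / 3 : ℝ)) with hμ
  set μ₂ : ℝ := lam ^ (-(4 / 3 : ℝ)) with hμ₂
  have hμ0 : 0 < μ := Real.rpow_pos_of_pos hlam0 _
  have hμ₂0 : 0 < μ₂ := Real.rpow_pos_of_pos hlam0 _
  have hμsq : μ ^ 2 = μ₂ := by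
    rw [hμ, hμ₂, ← Real.rpow_natCast, ← Real.rpow_mul hlam0.le]
    norm_num
  have hprod : μ₂ * μ = (lam ^ 2)⁻¹ := by
    rw [hμ, hμ₂, ← Real.rpow_add hlam0, ← Real.rpow_natCast, ← Real.rpow_neg hlam0.le]
    norm_num
  -- the integrands
  set f : EuclideanSpace ℝ (Fin 3) → ℝ := fun x =>
    c * Real.arctan ((‖V x‖ ^ 2 / 2 + P x) / c) * (⟪V x, x⟫ / ‖x‖ ^ 2) * ζ (‖x‖ ^ 2 / lam ^ 2)
    with hf
  set g : EuclideanSpace ℝ (Fin 3) → ℝ := fun x =>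
    c / μ₂ * Real.arctan ((‖V x‖ ^ 2 / 2 + P x) / (c / μ₂)) * (⟪V x, x⟫ / ‖x‖ ^ 2) * ζ (‖x‖ ^ 2)
    with hg
  have hpt : ∀ y : EuclideanSpace ℝ (Fin 3), f (lam • y) = (μ₂ * μ / lam) * g y := by
    intro y
    rcases eq_or_ne y 0 with rfl | hy
    · simp [hf, hg]
    · have hn : ‖lam • y‖ ^ 2 = lam ^ 2 * ‖y‖ ^ 2 := by
        rw [norm_smul, Real.norm_eq_abs, abs_of_pos hlam0, mul_pow]
      have hy2 : ‖y‖ ^ 2 ≠ 0 := by positivity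
      have hhead : ‖V (lam • y)‖ ^ 2 / 2 + P (lam • y) = μ₂ * (‖V y‖ ^ 2 / 2 + P y) := by
        simp only [hVs y hy, hPs y hy, norm_smul, Real.norm_eq_abs, abs_of_pos hμ0, mul_pow, hμsq]
        ring
      have hrad : ⟪V (lam • y), lam • y⟫ / ‖lam • y‖ ^ 2 = μ / lam * (⟪V y, y⟫ / ‖y‖ ^ 2) := by
        simp only [hVs y hy, real_inner_smul_left, real_inner_smul_right, hn]
        field_simp
      have harc : c * Real.arctan (μ₂ * (‖V y‖ ^ 2 / 2 + P y) / c) =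
          μ₂ * (c / μ₂ * Real.arctan ((‖V y‖ ^ 2 / 2 + P y) / (c / μ₂))) := by
        rw [div_div_eq_mul_div, mul_comm (‖V y‖ ^ 2 / 2 + P y) μ₂]
        field_simp
      have hζarg : ‖lam • y‖ ^ 2 / lam ^ 2 = ‖y‖ ^ 2 := by
        rw [hn]; field_simp
      simp only [hf, hg, hhead, hrad, hζarg, harc]
      ring
  have hsub := Measure.integral_comp_smul_of_nonneg volume f lam (hR := hlam0.le)
  rw [finrank_euclideanSpace_fin] at hsub
  show ∫ x, f x = ∫ y, g y
  calc ∫ x, f x = lam ^ 3 * ∫ y, f (lam • y) := by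
        rw [hsub, smul_eq_mul, ← mul_assoc, mul_inv_cancel₀ (pow_ne_zero 3 hlam0.ne'), one_mul]
    _ = lam ^ 3 * ∫ y, (μ₂ * μ / lam) * g y := by rw [integral_congr_ae (Eventually.of_forall hpt)]
    _ = lam ^ 3 * (μ₂ * μ / lam) * ∫ y, g y := by rw [integral_const_mul, mul_assoc]
    _ = ∫ y, g y := by
        rw [hprod]
        field_simp

/-- **Steps 1 + 2**: the arctan level functional is invariant under the level shift
`c ↦ c / λ^{−4/3} = λ^{4/3} c`. [folklore] -/
theorem integral_level_eq_shift (hlam : 1 < lam) (hV : ContDiffOn ℝ 1 V {x | x ≠ 0})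
    (hP : ContDiffOn ℝ 1 P {x | x ≠ 0})
    (hVs : ∀ x : EuclideanSpace ℝ (Fin 3), x ≠ 0 → V (lam • x) = lam ^ (-(2 / 3 : ℝ)) • V x)
    (hPs : ∀ x : EuclideanSpace ℝ (Fin 3), x ≠ 0 → P (lam • x) = lam ^ (-(4 / 3 : ℝ)) * P x)
    (hdiv : ∀ x : EuclideanSpace ℝ (Fin 3), x ≠ 0 → VectorCalculus.divergence V x = 0)
    (hmom : ∀ x : EuclideanSpace ℝ (Fin 3), x ≠ 0 → convect V V x + gradient P x = 0)
    {c : ℝ} (hc : 0 < c) {ζ : ℝ → ℝ} (hζ : Continuous ζ) {a b : ℝ} (ha : 0 < a) (hab : a ≤ b)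
    (hζa : ∀ u, u ≤ a → ζ u = 0) (hζb : ∀ u, b ≤ u → ζ u = 0) :
    ∫ x, c * Real.arctan ((‖V x‖ ^ 2 / 2 + P x) / c) * (⟪V x, x⟫ / ‖x‖ ^ 2) * ζ (‖x‖ ^ 2) =
      ∫ x, c / lam ^ (-(4 / 3 : ℝ)) *
        Real.arctan ((‖V x‖ ^ 2 / 2 + P x) / (c / lam ^ (-(4 / 3 : ℝ)))) *
          (⟪V x, x⟫ / ‖x‖ ^ 2) * ζ (‖x‖ ^ 2) := by
  rw [← integral_level_comp_div_eq hlam hVs hPs c ζ]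
  exact integral_transport_invariant hV hP hdiv hmom (h := fun s => c * Real.arctan (s / c))
    (fun s => ThinSetLiouville.hasDerivAt_mul_arctan_div hc s)
    (continuous_const.div (continuous_const.add ((continuous_id.div_const _).pow 2))
      fun s => (by positivity : (0 : ℝ) < 1 + (s / c) ^ 2).ne')
    hζ ha hab (by nlinarith) hζa hζb

/-- `N_{q^k}(ζ) = N_1(ζ)` for `q = λ^{4/3}` (iterate the level shift upwards). [folklore] -/
theorem integral_level_inv_pow_eq (hlam : 1 < lam) (hV : ContDiffOn ℝ 1 V {x | x ≠ 0})
    (hP : ContDiffOn ℝ 1 P {x | x ≠ 0})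
    (hVs : ∀ x : EuclideanSpace ℝ (Fin 3), x ≠ 0 → V (lam • x) = lam ^ (-(2 / 3 : ℝ)) • V x)
    (hPs : ∀ x : EuclideanSpace ℝ (Fin 3), x ≠ 0 → P (lam • x) = lam ^ (-(4 / 3 : ℝ)) * P x)
    (hdiv : ∀ x : EuclideanSpace ℝ (Fin 3), x ≠ 0 → VectorCalculus.divergence V x = 0)
    (hmom : ∀ x : EuclideanSpace ℝ (Fin 3), x ≠ 0 → convect V V x + gradient P x = 0)
    {ζ : ℝ → ℝ} (hζ : Continuous ζ) {a b : ℝ} (ha : 0 < a) (hab : a ≤ b)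
    (hζa : ∀ u, u ≤ a → ζ u = 0) (hζb : ∀ u, b ≤ u → ζ u = 0) (k : ℕ) :
    ∫ x, (lam ^ (-(4 / 3 : ℝ)))⁻¹ ^ k *
        Real.arctan ((‖V x‖ ^ 2 / 2 + P x) / ((lam ^ (-(4 / 3 : ℝ)))⁻¹ ^ k)) *
          (⟪V x, x⟫ / ‖x‖ ^ 2) * ζ (‖x‖ ^ 2) =
      ∫ x, 1 * Real.arctan ((‖V x‖ ^ 2 / 2 + P x) / 1) * (⟪V x, x⟫ / ‖x‖ ^ 2) * ζ (‖x‖ ^ 2) := by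
  have hq0 : 0 < (lam ^ (-(4 / 3 : ℝ)))⁻¹ :=
    inv_pos.2 (Real.rpow_pos_of_pos (zero_lt_one.trans hlam) _)
  induction k with
  | zero =>
      rw [pow_zero]
  | succ k ih =>
      rw [pow_succ, ← div_eq_mul_inv, ← integral_level_eq_shift hlam hV hP hVs hPs hdiv hmom
        (pow_pos hq0 k) hζ ha hab hζa hζb, ih]

/-- `N_{q^{-k}}(ζ) = N_1(ζ)` for `q = λ^{4/3}` (iterate the level shift downwards). [folklore] -/
theorem integral_level_pow_eq (hlam : 1 < lam) (hV : ContDiffOn ℝ 1 V {x | x ≠ 0})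
    (hP : ContDiffOn ℝ 1 P {x | x ≠ 0})
    (hVs : ∀ x : EuclideanSpace ℝ (Fin 3), x ≠ 0 → V (lam • x) = lam ^ (-(2 / 3 : ℝ)) • V x)
    (hPs : ∀ x : EuclideanSpace ℝ (Fin 3), x ≠ 0 → P (lam • x) = lam ^ (-(4 / 3 : ℝ)) * P x)
    (hdiv : ∀ x : EuclideanSpace ℝ (Fin 3), x ≠ 0 → VectorCalculus.divergence V x = 0)
    (hmom : ∀ x : EuclideanSpace ℝ (Fin 3), x ≠ 0 → convect V V x + gradient P x = 0)
    {ζ : ℝ → ℝ} (hζ : Continuous ζ) {a b : ℝ} (ha : 0 < a) (hab : a ≤ b)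
    (hζa : ∀ u, u ≤ a → ζ u = 0) (hζb : ∀ u, b ≤ u → ζ u = 0) (k : ℕ) :
    ∫ x, (lam ^ (-(4 / 3 : ℝ))) ^ k *
        Real.arctan ((‖V x‖ ^ 2 / 2 + P x) / ((lam ^ (-(4 / 3 : ℝ))) ^ k)) *
          (⟪V x, x⟫ / ‖x‖ ^ 2) * ζ (‖x‖ ^ 2) =
      ∫ x, 1 * Real.arctan ((‖V x‖ ^ 2 / 2 + P x) / 1) * (⟪V x, x⟫ / ‖x‖ ^ 2) * ζ (‖x‖ ^ 2) := by
  have hμ0 : 0 < lam ^ (-(4 / 3 : ℝ)) := Real.rpow_pos_of_pos (zero_lt_one.trans hlam) _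
  induction k with
  | zero =>
      rw [pow_zero]
  | succ k ih =>
      rw [integral_level_eq_shift hlam hV hP hVs hPs hdiv hmom (pow_pos hμ0 (k + 1)) hζ ha hab
        hζa hζb, pow_succ, mul_div_cancel_right₀ _ hμ0.ne', ih]

/-- **Step 3a (limit `c → ∞`).** `N_{c_k}(ζ) → ∫ B ⟪V,x⟫|x|⁻² ζ(|x|²)` along any positive
sequence `c_k → ∞` (dominated convergence, `|c·arctan(B/c)| ≤ |B|`). [folklore] -/
theorem tendsto_integral_level_atTop (hV : ContDiffOn ℝ 1 V {x | x ≠ 0})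
    (hP : ContDiffOn ℝ 1 P {x | x ≠ 0}) {ζ : ℝ → ℝ} (hζ : Continuous ζ) {a b : ℝ} (ha : 0 < a)
    (hab : a ≤ b) (hζa : ∀ u, u ≤ a → ζ u = 0) (hζb : ∀ u, b ≤ u → ζ u = 0) {c : ℕ → ℝ}
    (hc : ∀ k, 0 < c k) (hc' : Tendsto c atTop atTop) :
    Tendsto (fun k => ∫ x, c k * Real.arctan ((‖V x‖ ^ 2 / 2 + P x) / c k) *
      (⟪V x, x⟫ / ‖x‖ ^ 2) * ζ (‖x‖ ^ 2)) atTop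
      (𝓝 (∫ x, (‖V x‖ ^ 2 / 2 + P x) * (⟪V x, x⟫ / ‖x‖ ^ 2) * ζ (‖x‖ ^ 2))) := by
  refine tendsto_integral_of_dominated_convergence
    (fun x => |(‖V x‖ ^ 2 / 2 + P x) * (⟪V x, x⟫ / ‖x‖ ^ 2) * ζ (‖x‖ ^ 2)|)
    (fun k => ?_) ?_ (fun k => ?_) ?_
  · exact (continuous_mul_radial (continuousOn_profileIntegrand hV hP
      (continuous_const.mul (Real.continuous_arctan.comp (continuous_id.div_const _))))
      hζ ha hζa).aestronglyMeasurable
  · exact (integrable_mul_radial (continuousOn_fluxIntegrand hV hP) hζ ha hab hζa hζb).abs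
  · refine Eventually.of_forall fun x => ?_
    have hB : |(‖V x‖ ^ 2 / 2 + P x) * (⟪V x, x⟫ / ‖x‖ ^ 2) * ζ (‖x‖ ^ 2)| =
        |‖V x‖ ^ 2 / 2 + P x| * |⟪V x, x⟫ / ‖x‖ ^ 2| * |ζ (‖x‖ ^ 2)| := by rw [abs_mul, abs_mul]
    rw [Real.norm_eq_abs, hB, abs_mul, abs_mul]
    exact mul_le_mul_of_nonneg_right (mul_le_mul_of_nonneg_right
      (abs_mul_arctan_div_le_abs (hc k) _) (abs_nonneg _)) (abs_nonneg _)
  · refine Eventually.of_forall fun x => ?_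
    exact (((tendsto_mul_arctan_div_atTop (‖V x‖ ^ 2 / 2 + P x)).comp hc').mul_const
      (⟪V x, x⟫ / ‖x‖ ^ 2)).mul_const (ζ (‖x‖ ^ 2))

/-- **Step 3b (limit `c → 0⁺`).** `N_{c_k}(ζ) → 0` along any positive sequence `c_k → 0`. [folklore] -/
theorem tendsto_integral_level_zero (hV : ContDiffOn ℝ 1 V {x | x ≠ 0})
    (hP : ContDiffOn ℝ 1 P {x | x ≠ 0}) {ζ : ℝ → ℝ} (hζ : Continuous ζ) {a b : ℝ} (ha : 0 < a)
    (hab : a ≤ b) (hζa : ∀ u, u ≤ a → ζ u = 0) (hζb : ∀ u, b ≤ u → ζ u = 0) {c : ℕ → ℝ}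
    (hc : ∀ k, 0 < c k) (hc' : Tendsto c atTop (𝓝 0)) :
    Tendsto (fun k => ∫ x, c k * Real.arctan ((‖V x‖ ^ 2 / 2 + P x) / c k) *
      (⟪V x, x⟫ / ‖x‖ ^ 2) * ζ (‖x‖ ^ 2)) atTop (𝓝 0) := by
  have hc'' : Tendsto c atTop (𝓝[>] 0) :=
    tendsto_nhdsWithin_iff.2 ⟨hc', Eventually.of_forall hc⟩
  have h := tendsto_integral_of_dominated_convergence
    (μ := (volume : Measure (EuclideanSpace ℝ (Fin 3))))
    (F := fun k x => c k * Real.arctan ((‖V x‖ ^ 2 / 2 + P x) / c k) *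
      (⟪V x, x⟫ / ‖x‖ ^ 2) * ζ (‖x‖ ^ 2))
    (f := fun _ => 0)
    (fun x => |(‖V x‖ ^ 2 / 2 + P x) * (⟪V x, x⟫ / ‖x‖ ^ 2) * ζ (‖x‖ ^ 2)|)
    (fun k => ?_) ?_ (fun k => ?_) ?_
  · simpa using h
  · exact (continuous_mul_radial (continuousOn_profileIntegrand hV hP
      (continuous_const.mul (Real.continuous_arctan.comp (continuous_id.div_const _))))
      hζ ha hζa).aestronglyMeasurable
  · exact (integrable_mul_radial (continuousOn_fluxIntegrand hV hP) hζ ha hab hζa hζb).abs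
  · refine Eventually.of_forall fun x => ?_
    have hB : |(‖V x‖ ^ 2 / 2 + P x) * (⟪V x, x⟫ / ‖x‖ ^ 2) * ζ (‖x‖ ^ 2)| =
        |‖V x‖ ^ 2 / 2 + P x| * |⟪V x, x⟫ / ‖x‖ ^ 2| * |ζ (‖x‖ ^ 2)| := by rw [abs_mul, abs_mul]
    rw [Real.norm_eq_abs, hB, abs_mul, abs_mul]
    exact mul_le_mul_of_nonneg_right (mul_le_mul_of_nonneg_right
      (abs_mul_arctan_div_le_abs (hc k) _) (abs_nonneg _)) (abs_nonneg _)
  · refine Eventually.of_forall fun x => ?_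
    have h := (((tendsto_mul_arctan_div_zero (‖V x‖ ^ 2 / 2 + P x)).comp hc'').mul_const
      (⟪V x, x⟫ / ‖x‖ ^ 2)).mul_const (ζ (‖x‖ ^ 2))
    simpa using h

/-- **Steps 1–3 assembled.** For a classical DSS steady Euler pair of degrees `(−2/3, −4/3)` off
the origin, `∫ (½|V|² + P) ⟪V,x⟫|x|⁻² ζ(|x|²) dx = 0` for every continuous profile `ζ` supported
in `[a, b] ⊂ (0, ∞)`: `N_1 = lim_k N_{λ^{-4k/3}} = 0` and `∫ B r ζ = lim_k N_{λ^{4k/3}} = N_1`.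
[folklore] -/
theorem integral_flux_weight_eq_zero (hlam : 1 < lam) (hV : ContDiffOn ℝ 1 V {x | x ≠ 0})
    (hP : ContDiffOn ℝ 1 P {x | x ≠ 0})
    (hVs : ∀ x : EuclideanSpace ℝ (Fin 3), x ≠ 0 → V (lam • x) = lam ^ (-(2 / 3 : ℝ)) • V x)
    (hPs : ∀ x : EuclideanSpace ℝ (Fin 3), x ≠ 0 → P (lam • x) = lam ^ (-(4 / 3 : ℝ)) * P x)
    (hdiv : ∀ x : EuclideanSpace ℝ (Fin 3), x ≠ 0 → VectorCalculus.divergence V x = 0)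
    (hmom : ∀ x : EuclideanSpace ℝ (Fin 3), x ≠ 0 → convect V V x + gradient P x = 0)
    {ζ : ℝ → ℝ} (hζ : Continuous ζ) {a b : ℝ} (ha : 0 < a) (hab : a ≤ b)
    (hζa : ∀ u, u ≤ a → ζ u = 0) (hζb : ∀ u, b ≤ u → ζ u = 0) :
    ∫ x, (‖V x‖ ^ 2 / 2 + P x) * (⟪V x, x⟫ / ‖x‖ ^ 2) * ζ (‖x‖ ^ 2) = 0 := by
  have hlam0 : 0 < lam := zero_lt_one.trans hlam
  set μ₂ : ℝ := lam ^ (-(4 / 3 : ℝ)) with hμ₂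
  have hμ₂0 : 0 < μ₂ := Real.rpow_pos_of_pos hlam0 _
  have hμ₂1 : μ₂ < 1 := Real.rpow_lt_one_of_one_lt_of_neg hlam (by norm_num)
  -- `N_1 = 0`
  have h1 : Tendsto (fun k : ℕ => ∫ x, μ₂ ^ k * Real.arctan ((‖V x‖ ^ 2 / 2 + P x) / μ₂ ^ k) *
      (⟪V x, x⟫ / ‖x‖ ^ 2) * ζ (‖x‖ ^ 2)) atTop (𝓝 0) :=
    tendsto_integral_level_zero hV hP hζ ha hab hζa hζb (fun k => pow_pos hμ₂0 k)
      (tendsto_pow_atTop_nhds_zero_of_lt_one hμ₂0.le hμ₂1)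
  have h1' : (fun k : ℕ => ∫ x, μ₂ ^ k * Real.arctan ((‖V x‖ ^ 2 / 2 + P x) / μ₂ ^ k) *
      (⟪V x, x⟫ / ‖x‖ ^ 2) * ζ (‖x‖ ^ 2)) = fun _ =>
      ∫ x, 1 * Real.arctan ((‖V x‖ ^ 2 / 2 + P x) / 1) * (⟪V x, x⟫ / ‖x‖ ^ 2) * ζ (‖x‖ ^ 2) :=
    funext fun k => integral_level_pow_eq hlam hV hP hVs hPs hdiv hmom hζ ha hab hζa hζb k
  rw [h1'] at h1
  have hN1 := tendsto_const_nhds_iff.1 h1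
  -- `∫ B r ζ = N_1`
  have h2 : Tendsto (fun k : ℕ => ∫ x, μ₂⁻¹ ^ k * Real.arctan ((‖V x‖ ^ 2 / 2 + P x) / μ₂⁻¹ ^ k) *
      (⟪V x, x⟫ / ‖x‖ ^ 2) * ζ (‖x‖ ^ 2)) atTop
      (𝓝 (∫ x, (‖V x‖ ^ 2 / 2 + P x) * (⟪V x, x⟫ / ‖x‖ ^ 2) * ζ (‖x‖ ^ 2))) :=
    tendsto_integral_level_atTop hV hP hζ ha hab hζa hζb (fun k => pow_pos (inv_pos.2 hμ₂0) k)
      (tendsto_pow_atTop_atTop_of_one_lt ((one_lt_inv₀ hμ₂0).2 hμ₂1))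
  have h2' : (fun k : ℕ => ∫ x, μ₂⁻¹ ^ k * Real.arctan ((‖V x‖ ^ 2 / 2 + P x) / μ₂⁻¹ ^ k) *
      (⟪V x, x⟫ / ‖x‖ ^ 2) * ζ (‖x‖ ^ 2)) = fun _ =>
      ∫ x, 1 * Real.arctan ((‖V x‖ ^ 2 / 2 + P x) / 1) * (⟪V x, x⟫ / ‖x‖ ^ 2) * ζ (‖x‖ ^ 2) :=
    funext fun k => integral_level_inv_pow_eq hlam hV hP hVs hPs hdiv hmom hζ ha hab hζa hζb k
  rw [h2', hN1] at h2
  exact (tendsto_const_nhds_iff.1 h2).symm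

end Functionals

end Summit.AnomalousDissipation.AnomalousDissipation.Theorems.PointFluxCone.Negative

end
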